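import Summits.BirchSwinnertonDyer.BirchSwinnertonDyer.Theorems.ManinLocalTwoThreeCubeStep
import Summits.BirchSwinnertonDyer.BirchSwinnertonDyer.Theorems.ManinLocalTwoThreeThreeShiftStepNine
import Summits.BirchSwinnertonDyer.BirchSwinnertonDyer.Theorems.ManinLocalTwoThreeThreeShiftDescentTwentySeven
import HarnessLib

/-!
# The nine-shift equaliser law: what is left after the cube steps, step nine and the descents above depth 27
# (route `ManinLocalTwoThree`, cell bsd-f2-manin; crux C3 `ManinPrimeToThreeAtNine` stmt-BirchSwinnertonDyer-22968; prover seat p3 gen 10)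

es g23's fine reduction (`NineShiftFineReduction.lean`) derives E-es-94♯ `NineShiftInvariantIsDiamond` from THEOREM III
(`ThreeShiftTowerDescent`) and five single-step nodes E-es-102…106.  Of these, the tree now PROVES E-es-101 (`towerReduction_holds`),
E-es-99 (`threeShiftAntiInvariantDescent_holds`), THEOREM III at every `27 ∣ M` (`threeShiftTowerDescent_of_twentySeven_dvd`),
E-es-105 (`threeShiftStepNine_holds`), E-es-103 (`cubeStepDescent_holds`) and E-es-104 (`cubeStepAntiDescent_holds`).
This file records the EXACT residue as three single-depth STEP laws at the `K₃,₃` steps `3N₀ → 9N₀ → 27N₀` (`3 ∤ N₀`), each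
WEAKER than the corresponding es descent node (edges `…_of_towerDescent`, `…_of_descentAll`), and proves
**`nineShiftInvariantIsDiamond_of_steps : ThreeShiftBasePrimeToThree → ThreeShiftStepTwentySeven → AntiInvariantStepNine →
AntiInvariantStepTwentySeven → NineShiftInvariantIsDiamond`**: E-es-94♯ at every `9 ∣ N` follows from the prime-to-3 base
(E-es-102 ⟸ Serre's amalgam, es E-es-107) and the three `K₃,₃` steps (es THEOREMS III at `9 ∥ M`, V, III″ — the Heisenberg-pair steps).
TYPER-STYLE FRAMING of the three new rows (E-p3-S27, E-p3-S9⁻, E-p3-S27⁻): lens p3; LAWS (obligation nodes), NOTHING ASSERTED; each is a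
theorem on paper per es (MEMO-es §37.8 THM III, §37.9 (6) THMS V / III″), referee R-es-48 pending.  Nothing about BSD or Manin's conjecture
is asserted here.
-/

set_option autoImplicit false
set_option linter.dupNamespace false

open scoped MatrixGroups

open CongruenceSubgroup Matrix.SpecialLinearGroup
  Summit.BirchSwinnertonDyer.Rank1Residual.ManinAdditive.NineShiftEqualiser

namespace Summit.BirchSwinnertonDyer.BirchSwinnertonDyer.Theorems.ManinLocalTwoThree

/-- LAW E-p3-S27 (the invariant `K₃,₃` step at depth `9 → 27`): `K₃^grp(9N₀) = D^grp(9N₀) ⟹ K₃^grp(27N₀) = D^grp(27N₀)`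
for `3 ∤ N₀`.  Weaker than THEOREM III (E-es-98 `ThreeShiftTowerDescent`) at `M = 9N₀`; es ENGINE 5 Tables A/C.
FRAMING (E-p3-S27): lens p3; LAW (obligation node), nothing asserted. [conjecture — cell candidate, NOT a tree fact] -/
@[conjecture] def ThreeShiftStepTwentySeven : Prop :=
  ∀ N₀ : ℕ, 0 < N₀ → ¬ 3 ∣ N₀ → ThreeShiftInvariantIsDiamondAt (9 * N₀) → ThreeShiftInvariantIsDiamondAt (27 * N₀)

/-- LAW E-p3-S9⁻ (the anti-invariant `K₃,₃` step at depth `3 → 9`): `K₃⁻(3N₀) = 0 ⟹ K₃⁻(9N₀) = 0` for `3 ∤ N₀`.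
Weaker than es THEOREM V (E-es-106 `ThreeShiftAntiInvariantDescentAll` at `M = 3N₀`); es ENGINE 5 Table B.
FRAMING (E-p3-S9⁻): lens p3; LAW (obligation node), nothing asserted. [conjecture — cell candidate, NOT a tree fact] -/
@[conjecture] def AntiInvariantStepNine : Prop :=
  ∀ N₀ : ℕ, 0 < N₀ → ¬ 3 ∣ N₀ → ThreeShiftAntiInvariantTrivialAt (3 * N₀) → ThreeShiftAntiInvariantTrivialAt (9 * N₀)

/-- LAW E-p3-S27⁻ (the anti-invariant `K₃,₃` step at depth `9 → 27`): `K₃⁻(9N₀) = 0 ⟹ K₃⁻(27N₀) = 0` for `3 ∤ N₀`.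
Weaker than es THEOREM III″ (E-es-106 at `M = 9N₀`); es ENGINE 5 Table B.
FRAMING (E-p3-S27⁻): lens p3; LAW (obligation node), nothing asserted. [conjecture — cell candidate, NOT a tree fact] -/
@[conjecture] def AntiInvariantStepTwentySeven : Prop :=
  ∀ N₀ : ℕ, 0 < N₀ → ¬ 3 ∣ N₀ → ThreeShiftAntiInvariantTrivialAt (9 * N₀) → ThreeShiftAntiInvariantTrivialAt (27 * N₀)

/-! ### The three step laws are weaker than es's descent nodes -/

/-- E-p3-S27 ⟸ THEOREM III (E-es-98 `ThreeShiftTowerDescent`, used at `M = 9N₀` only). [folklore] -/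
theorem threeShiftStepTwentySeven_of_towerDescent (hIII : ThreeShiftTowerDescent) : ThreeShiftStepTwentySeven := by
  intro N₀ _ _ h9
  rw [show 27 * N₀ = 3 * (9 * N₀) by ring]
  intro φ hadd hinv
  obtain ⟨w, hwa, hwi, hr⟩ := hIII (9 * N₀) ⟨N₀, rfl⟩ φ hadd hinv
  exact isDiamondChar_of_restrictsFrom ⟨3, by ring⟩ hr (h9 w hwa hwi)

/-- E-p3-S9⁻ ⟸ E-es-106 `ThreeShiftAntiInvariantDescentAll` (used at `M = 3N₀` only; es THEOREM V). [folklore] -/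
theorem antiInvariantStepNine_of_descentAll (h : ThreeShiftAntiInvariantDescentAll) : AntiInvariantStepNine := by
  intro N₀ _ _ h3
  rw [show 9 * N₀ = 3 * (3 * N₀) by ring]
  intro ψ hadd hanti γ
  obtain ⟨w, hwa, hwi, hr⟩ := h (3 * N₀) (3 * (3 * N₀)) ⟨N₀, rfl⟩ rfl ψ hadd hanti
  exact eq_zero_of_restrictsFrom ⟨3, by ring⟩ hr (h3 w hwa hwi) γ

/-- E-p3-S27⁻ ⟸ E-es-106 `ThreeShiftAntiInvariantDescentAll` (used at `M = 9N₀` only; es THEOREM III″). [folklore] -/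
theorem antiInvariantStepTwentySeven_of_descentAll (h : ThreeShiftAntiInvariantDescentAll) :
    AntiInvariantStepTwentySeven := by
  intro N₀ _ _ h9
  rw [show 27 * N₀ = 3 * (9 * N₀) by ring]
  intro ψ hadd hanti γ
  obtain ⟨w, hwa, hwi, hr⟩ := h (9 * N₀) (3 * (9 * N₀)) ⟨3 * N₀, by ring⟩ rfl ψ hadd hanti
  exact eq_zero_of_restrictsFrom ⟨3, by ring⟩ hr (h9 w hwa hwi) γ

/-! ### What the tree proves at the prime-to-3 and cube levels -/

/-- `K₃(9N₀) = D(9N₀)` from the prime-to-3 base: base (E-es-102) → cube step (PROVED `cubeStepDescent_holds`) → step nine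
(PROVED `threeShiftStepNine_holds`).  This is es's `fine_reduction`, first component, with the two proved nodes discharged.
[folklore] -/
theorem threeShiftBaseNine_of_base (hbase : ThreeShiftBasePrimeToThree) : ThreeShiftBaseNine := by
  intro N₀ hpos h3
  have hK : ThreeShiftInvariantIsDiamondAt N₀ := (hbase N₀ hpos h3).1
  have h3N : ThreeShiftInvariantIsDiamondAt (3 * N₀) := by
    intro φ hadd hinv
    obtain ⟨w, hwa, hwi, hr⟩ := CubeStep.cubeStepDescent_holds N₀ (3 * N₀) hpos h3 rfl φ hadd hinv
    exact isDiamondChar_of_restrictsFrom (dvd_mul_left N₀ 3) hr (hK w hwa hwi)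
  exact threeShiftStepNine_holds N₀ hpos h3 h3N

/-- `K₃⁻(3N₀) = 0` from the prime-to-3 base and the PROVED cube anti-step `cubeStepAntiDescent_holds`. [folklore] -/
theorem antiInvariantTrivialAt_three_mul (hbase : ThreeShiftBasePrimeToThree) {N₀ : ℕ} (hpos : 0 < N₀) (h3 : ¬ 3 ∣ N₀) :
    ThreeShiftAntiInvariantTrivialAt (3 * N₀) := by
  intro ψ hadd hanti γ
  obtain ⟨w, hwa, hwi, hr⟩ := CubeStep.cubeStepAntiDescent_holds N₀ (3 * N₀) hpos h3 rfl ψ hadd hanti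
  exact eq_zero_of_restrictsFrom (dvd_mul_left N₀ 3) hr ((hbase N₀ hpos h3).2 w hwa hwi) γ

/-! ### The residue of E-es-94♯ -/

/-- **E-es-94♯ from the prime-to-3 base and the three `K₃,₃` step laws.**  `NineShiftInvariantIsDiamond` (the sharp nine-shift
equaliser law at every `9 ∣ N`) follows from E-es-102 `ThreeShiftBasePrimeToThree` (⟸ Serre's amalgam, es E-es-107), E-p3-S27,
E-p3-S9⁻ and E-p3-S27⁻; everything else in es's fine reduction — E-es-99, 101, 103, 104, 105 and THEOREM III above depth 27 — is a
theorem of the tree. [new: composition of the proved nodes] -/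
theorem nineShiftInvariantIsDiamond_of_steps (hbase : ThreeShiftBasePrimeToThree) (hS27 : ThreeShiftStepTwentySeven)
    (hS9m : AntiInvariantStepNine) (hS27m : AntiInvariantStepTwentySeven) : NineShiftInvariantIsDiamond := by
  refine nineShiftInvariantIsDiamond_of_bases (threeShiftBaseNine_of_base hbase) ?_ ?_
  · intro N₀ hpos h3
    exact hS27 N₀ hpos h3 (threeShiftBaseNine_of_base hbase N₀ hpos h3)
  · intro N₀ hpos h3
    exact hS27m N₀ hpos h3 (hS9m N₀ hpos h3 (antiInvariantTrivialAt_three_mul hbase hpos h3))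

/-- The same with es's own node names: E-es-94♯ ⟸ {E-es-102, THEOREM III, E-es-106} — the cube steps, step nine and the glue are
discharged. [new: composition of the proved nodes] -/
theorem nineShiftInvariantIsDiamond_of_base_III_antiAll (hbase : ThreeShiftBasePrimeToThree) (hIII : ThreeShiftTowerDescent)
    (hanti : ThreeShiftAntiInvariantDescentAll) : NineShiftInvariantIsDiamond :=
  nineShiftInvariantIsDiamond_of_steps hbase (threeShiftStepTwentySeven_of_towerDescent hIII)
    (antiInvariantStepNine_of_descentAll hanti) (antiInvariantStepTwentySeven_of_descentAll hanti)

end Summit.BirchSwinnertonDyer.BirchSwinnertonDyer.Theorems.ManinLocalTwoThree
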